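import Summits.BirchSwinnertonDyer.BirchSwinnertonDyer.Theorems.TameQuarticManinParityModThreeSaturationOfAvoids
import Summits.BirchSwinnertonDyer.BirchSwinnertonDyer.Theorems.TameQuarticManinParityPrymDefectAvoidsThreeOfEisensteinSplit
import Summits.BirchSwinnertonDyer.BirchSwinnertonDyer.Theorems.TameQuarticManinParityIrrModThreeSplitTraceWitness
import Summits.BirchSwinnertonDyer.BirchSwinnertonDyer.Theorems.TameQuarticManinParityNormImageAvoidsThreeOfLevelThird
import Summits.BirchSwinnertonDyer.BirchSwinnertonDyer.Theorems.TameQuarticManinParityEisensteinSplitOfFixedPointSymbols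
import Summits.BirchSwinnertonDyer.BirchSwinnertonDyer.Theorems.TameQuarticManinParityTprimeIrrModThreeSaturationFixedPointSymbolHeckeShift
import Summits.BirchSwinnertonDyer.BirchSwinnertonDyer.Theorems.TameQuarticManinParityPrymLatticeFixedPointSpanOfPeriodKernelFact
import Summits.BirchSwinnertonDyer.BirchSwinnertonDyer.Theorems.TameQuarticManinParityLevelThirdAvoidsThreeOfNewformLift
import Summits.BirchSwinnertonDyer.BirchSwinnertonDyer.Theorems.TameQuarticManinParityCongruentNewformCarriesTorsionRepOfEverywhere
import Summits.BirchSwinnertonDyer.BirchSwinnertonDyer.Theorems.TameQuarticManinParitySerreWeightDichotomy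
import Summits.BirchSwinnertonDyer.BirchSwinnertonDyer.Theorems.TameQuarticManinParityModThreePeriodEigenclassLiftsToNewform
import Summits.BirchSwinnertonDyer.BirchSwinnertonDyer.Theorems.TameQuarticManinParityGammaOneNewformsFinite
import Summits.BirchSwinnertonDyer.BirchSwinnertonDyer.Theorems.TameQuarticManinParityNewformCoeffPrimesOverFinite
import Summits.BirchSwinnertonDyer.BirchSwinnertonDyer.Theorems.TameQuarticManinParityTorsionRepRigidOfCongruentFrobenius
import Summits.BirchSwinnertonDyer.BirchSwinnertonDyer.Theorems.TameQuarticManinParityCongruentNewformCarriesTorsionRepOfThm61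
import HarnessLib

/-!
# Crux MS `TprimeIrrModThreeSaturation` (stmt-BirchSwinnertonDyer-23367) from its LEAVES —
# LINE `abelian-fixed-points` closed modulo FOUR catalogued named facts and nothing else (lead g2)

`tprimeIrrModThreeSaturation_of_leaves`: the crux MS follows from
* (K) `Literature.NumberTheory.ModularSymbols.periodFunctional_ker_le_ellipticParabolic_sup_commutator` — Knapp 1993
  Prop. 11.22, the integral Manin presentation of `H₁(X₀(N), ℤ)` by periods (cite-only named fact; feeds E32a);
* (E) `Literature.NumberTheory.Automorphic.edixhoven1992_serreWeight_le_weight_of_newform` — Edixhoven 1992 Thm. 4.5;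
* (D) `Literature.NumberTheory.Automorphic.darmonDiamondTaylor1995_ordinary_of_weightTwo_newform_dvd_level` — DDT95 Thm. 3.1(g);
* (LIFT33 — PROVED, p683347 `modThreePeriodEigenclassLiftsToNewform_proof`, imported, no longer a hypothesis)
  `ModThreePeriodEigenclassLiftsToNewform` (stmt-23816; the W-free Deligne–Serre lift of mod-3 period eigenclasses);
* (FIN34a/b — PROVED, p683734 `gammaOneNewformsFinite_proof`, p684039 `newformCoeffPrimesOverFinite_proof`, imported, no longer
  hypotheses) `GammaOneNewformsFinite` (stmt-23839), `NewformCoeffPrimesOverFinite` (stmt-23840) — the finiteness leaves;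
* (CONG∞) `TorsionRepOfEverywhereCongruentNewform` (stmt-23841; the one Galois leaf) — by LINE 35 (planner bsd-idea-3 g10;
  X35/R35/RIG35/G35 LANDED by prover bsd-line-ttd-p1 g12: `framedRepConjugateOfCongruentFrobenius_proof`,
  `torsionRepRigidOfCongruentFrobenius_proof`, `torsionRepOfEverywhereCongruentNewform_of_rigid`) it follows from the
  named fact (61) `DeligneSerre1974.thm61_exists_adicGaloisRep` (Deligne 1971: the `λ`-adic representation of a weight-2
  newform at every place), `torsionRepOfEverywhereCongruentNewform_of_thm61` / `tprimeIrrCongruentNewformCarriesTorsionRep_of_thm61` (ttd-p1, p685388), whence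
  `tprimeIrrModThreeSaturation_of_namedFacts`: MS ⇐ (K) ∧ (E) ∧ (D) ∧ (61);
through the LANDED chain: MS ⇐ A29 ⇐ H1 ∧ H2 (p673284); H1 ⇐ L31 (p679768); L31 ⇐ G33(E, D, LIFT33, CONG33, W23b)
(p681634) with W23b PROVED (p679313) and LIFT33 PROVED (p683347); CONG33 ⇐ G34(FIN34a, FIN34b, CONG∞) (p681685) with FIN34a/b PROVED (p683734, p684039); H2 ⇐ E30 ∧ B30 (p673875) with B30
PROVED (p675317); E30 ⇐ E32a ∧ E32b (p679806) with E32b PROVED (p682044) and E32a ⇐ K (p679807).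
This supersedes the g0 closure `tprimeIrrModThreeSaturation_of_namedFacts` (bespoke facts F₁, F₂): every remaining hypothesis
of `tprimeIrrModThreeSaturation_of_namedFacts` is a catalogued single-source named fact.  CONDITIONAL RESULT; the crux item
stays open.  No multiplicity one anywhere.  No summit is proved; BSD is NOT proved.
-/

set_option autoImplicit false
-- D-0017: single-problem summit, so `Summit.BirchSwinnertonDyer.BirchSwinnertonDyer.…` repeats a namespace BY DESIGN.
set_option linter.dupNamespace false

noncomputable section

namespace Summit.BirchSwinnertonDyer.BirchSwinnertonDyer.Theorems.TameQuarticManinParity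

open Summit.BirchSwinnertonDyer.BirchSwinnertonDyer.Theses.TameQuarticManinParity

/-- **MS modulo its leaves** (`TprimeIrrModThreeSaturation`, stmt-BirchSwinnertonDyer-23367): Knapp's presentation (K),
Edixhoven's weight bound (E), DDT's ordinarity (D) and the everywhere-congruent Galois leaf (CONG∞, stmt-23841) imply the
crux, by the landed chain of the line `abelian-fixed-points` (E32b, B30, W23b, the Deligne–Serre lift LIFT33 and the
finiteness leaves FIN34a/b proved outright). [cite: Knapp1993, Prop. 11.22 (PDF p. 242)]
[cite: Edixhoven1992, Thm. 4.5] [cite: DarmonDiamondTaylor1995, Thm. 3.1 (g) (p. 86)] -/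
theorem tprimeIrrModThreeSaturation_of_leaves
    (hK : Literature.NumberTheory.ModularSymbols.periodFunctional_ker_le_ellipticParabolic_sup_commutator)
    (hE : Literature.NumberTheory.Automorphic.edixhoven1992_serreWeight_le_weight_of_newform)
    (hD : Literature.NumberTheory.Automorphic.darmonDiamondTaylor1995_ordinary_of_weightTwo_newform_dvd_level)
    (hC : TorsionRepOfEverywhereCongruentNewform) : TprimeIrrModThreeSaturation :=
  modThreeSaturation_of_fixedPartAvoidsThree
    (fixedPartAvoidsThree_of_normImage_of_prymDefect
      (normImageAvoidsThree_of_levelThird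
        (levelThirdAvoidsThree_of_newformLift hE hD modThreePeriodEigenclassLiftsToNewform_proof
          (congruentNewformCarriesTorsionRep_of_everywhere gammaOneNewformsFinite_proof newformCoeffPrimesOverFinite_proof hC)
          tprimeIrrKodairaThreeSerreWeightSix_proof))
      (prymDefectAvoidsThree_of_eisensteinSplit_of_traceWitness
        (heckeEisensteinSplit_of (prymLatticeFixedPointSpan_of_periodKernelFact hK) stub_fixedPointSymbolHeckeShift)
        stub_traceWitness))

/-- **MS modulo the three catalogued facts and the one remaining Galois route item** CONG33 = stmt-23817 (the Galois half of
L31): the same chain one level up (without the LINE 34 finiteness split). [cite: Knapp1993, Prop. 11.22 (PDF p. 242)] -/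
theorem tprimeIrrModThreeSaturation_of_congruent
    (hK : Literature.NumberTheory.ModularSymbols.periodFunctional_ker_le_ellipticParabolic_sup_commutator)
    (hE : Literature.NumberTheory.Automorphic.edixhoven1992_serreWeight_le_weight_of_newform)
    (hD : Literature.NumberTheory.Automorphic.darmonDiamondTaylor1995_ordinary_of_weightTwo_newform_dvd_level)
    (hCong : TprimeIrrCongruentNewformCarriesTorsionRep) :
    TprimeIrrModThreeSaturation :=
  modThreeSaturation_of_fixedPartAvoidsThree
    (fixedPartAvoidsThree_of_normImage_of_prymDefect
      (normImageAvoidsThree_of_levelThird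
        (levelThirdAvoidsThree_of_newformLift hE hD modThreePeriodEigenclassLiftsToNewform_proof hCong
          tprimeIrrKodairaThreeSerreWeightSix_proof))
      (prymDefectAvoidsThree_of_eisensteinSplit_of_traceWitness
        (heckeEisensteinSplit_of (prymLatticeFixedPointSpan_of_periodKernelFact hK) stub_fixedPointSymbolHeckeShift)
        stub_traceWitness))

/-- **L31 `TprimeIrrLevelThirdAvoidsThree` (stmt-BirchSwinnertonDyer-23690, the stub `stub_levelThirdAvoidsThree` of the
lead skeleton) modulo the three Galois-side named facts (E), (D), (61)**: G33 (`levelThirdAvoidsThree_of_newformLift`) with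
LIFT33 and W23b PROVED and CONG33 ⇐ (61).  CONDITIONAL RESULT. [cite: Edixhoven1992, Thm. 4.5]
[cite: DarmonDiamondTaylor1995, Thm. 3.1 (g) (p. 86)] [cite: DeligneSerreASENS1974, Thm. 6.1] -/
theorem levelThirdAvoidsThree_of_namedFacts
    (hE : Literature.NumberTheory.Automorphic.edixhoven1992_serreWeight_le_weight_of_newform)
    (hD : Literature.NumberTheory.Automorphic.darmonDiamondTaylor1995_ordinary_of_weightTwo_newform_dvd_level)
    (h61 : Literature.NumberTheory.EllipticCurves.ModularForms.DeligneSerre1974.thm61_exists_adicGaloisRep) :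
    TprimeIrrLevelThirdAvoidsThree :=
  levelThirdAvoidsThree_of_newformLift hE hD modThreePeriodEigenclassLiftsToNewform_proof
    (tprimeIrrCongruentNewformCarriesTorsionRep_of_thm61 h61) tprimeIrrKodairaThreeSerreWeightSix_proof

/-- **MS modulo exactly four catalogued named facts** (`TprimeIrrModThreeSaturation`, stmt-BirchSwinnertonDyer-23367):
(K) Knapp 1993 Prop. 11.22 (integral Manin presentation), (E) Edixhoven 1992 Thm. 4.5, (D) Darmon–Diamond–Taylor 1995
Thm. 3.1(g), (61) Deligne 1971 / Deligne–Serre 1974 Thm. 6.1 (the `λ`-adic representation of a weight-`2` newform) imply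
the crux — every other input of the line `abelian-fixed-points` (E32b, B30, W23b, LIFT33, FIN34a/b, X35, RIG35 and all
glue) is a landed theorem.  CONDITIONAL RESULT. [cite: Knapp1993, Prop. 11.22 (PDF p. 242)] [cite: Edixhoven1992, Thm. 4.5]
[cite: DarmonDiamondTaylor1995, Thm. 3.1 (g) (p. 86)] [cite: DeligneSerreASENS1974, Thm. 6.1] -/
theorem tprimeIrrModThreeSaturation_of_namedFacts
    (hK : Literature.NumberTheory.ModularSymbols.periodFunctional_ker_le_ellipticParabolic_sup_commutator)
    (hE : Literature.NumberTheory.Automorphic.edixhoven1992_serreWeight_le_weight_of_newform)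
    (hD : Literature.NumberTheory.Automorphic.darmonDiamondTaylor1995_ordinary_of_weightTwo_newform_dvd_level)
    (h61 : Literature.NumberTheory.EllipticCurves.ModularForms.DeligneSerre1974.thm61_exists_adicGaloisRep) :
    TprimeIrrModThreeSaturation :=
  tprimeIrrModThreeSaturation_of_leaves hK hE hD (torsionRepOfEverywhereCongruentNewform_of_thm61 h61)

end Summit.BirchSwinnertonDyer.BirchSwinnertonDyer.Theorems.TameQuarticManinParity

end
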